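import Literature.Topology.FourManifolds.StraighteningInvariance
import Literature.Topology.FourManifolds.GompfConjInvariance
import Literature.Topology.FourManifolds.InverseFunctionTheorem
import Mathlib.Analysis.InnerProductSpace.Calculus
import Mathlib.Analysis.SpecialFunctions.Log.Deriv
import HarnessLib

/-!
# Radial linearization: a closed formula for straightening a linear germ in the ball

Infrastructure for Gompf's straightenings (R. Gompf, *More Cappell–Shaneson spheres are standard*,
Algebr. Geom. Topol. 10 (2010), Def. 4.1 and §4 ¶2–3): given a smooth path of invertible matrices
`Q : 1 ⟿ N` (a `SmoothMatrixPath N`) we want a family of diffeomorphisms of `ℝ³`, equal to the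
*linear* map `Q(σ s)` on a small ball, to the identity off a larger ball, and — the point of the
closed formula, as opposed to integrating a cut-off linear vector field — **mapping every ray
`ℝ u` into the cone swept by `Q(τ) u`** (so that with a cone-nice `Q`, `GompfConePaths.lean`, a
coordinate circle is kept inside a flat coordinate torus: Gompf §4 ¶3). The formula is the
**radial linearization**

  `Φ_s(v) = Q(σ(s) χ(v)) v`,   `χ(v) = σ(1 + (log ρ - log max(‖v‖, ρ/2)) / L)`,

`σ` Mathlib's smooth transition: `χ = 1` on `‖v‖ ≤ ρ`, `χ = 0` on `‖v‖ ≥ ρ e^L`, and `χ` is a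
function of `log ‖v‖` with slope `≤ C_σ / L`. The logarithmic profile is what makes `Φ_s`
injective with invertible derivative as soon as `L` exceeds a constant `L₀(Q)` depending only on
bounds for `Q`, `Q⁻¹`, `Q'` (`radialScale Q`): comparing `Φ_s(v) = Φ_s(w)` with `‖v‖ ≤ ‖w‖` gives
`‖w‖ - ‖v‖ ≤ C |χ v - χ w| ‖v‖ ≤ (C C_σ / L) (‖w‖ - ‖v‖)`.

* `Literature.Topology.FourManifolds.logRadialCutoff ρ L` and its plateaus, range, monotonicity,
  smoothness and the logarithmic slope estimate `logRadialCutoff_sub_le`;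
* `Literature.Topology.FourManifolds.SmoothMatrixPath.entryBound / lipBound` — bounds `K ≥ 1` for
  the entries of `Q`, `Q⁻¹` and a Lipschitz constant `K'` for the entries of `Q`;
* `Literature.Topology.FourManifolds.radialLinMap Q ρ L s` = `Φ_s` and: `radialLinMap_of_norm_le`
  (linear on the `ρ`-ball), `radialLinMap_of_le_norm` (identity off the `ρ e^L`-ball), joint
  smoothness `contDiff_radialLinMap`, `norm_radialLinMap_lt` (the `ρ e^L`-ball is mapped into itself),
  `radialLinMap_injective` and `isLocalDiffeomorphAt_radialLinMap` for `L ≥ radialScale Q`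
  (`radialScale_pos`), and the ray property `radialLinMap_smul` (`Φ_s (θ u) = θ Q(σ(s) χ(θu)) u`).

Everything is proved; no named facts are introduced. The torus-level diffeotopy and the resulting
`Straightening` are in `GompfRadialStraightening.lean`.

## References

* R. E. Gompf, *More Cappell–Shaneson spheres are standard*, Algebr. Geom. Topol. 10 (2010)
  1665–1681, §4 Def. 4.1, ¶2–3. [GompfAGT2010]
* M. W. Hirsch, *Differential Topology* (1976), Ch. 8 §1 (isotopies linear near a point).
  [HirschDT1976]
-/

noncomputable section

open scoped ContDiff Topology Manifold Matrix.Norms.Operator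
open Set Function Metric Filter

namespace Literature.Topology.FourManifolds

/-- Local notation: `𝔼 n` is the model Euclidean space `EuclideanSpace ℝ (Fin n)`. -/
local notation "𝔼 " n:arg => EuclideanSpace ℝ (Fin n)

/-- Local notation: `𝕄` is the algebra of real `3 × 3` matrices (with the `ℓ∞`-operator norm). -/
local notation "𝕄" => Matrix (Fin 3) (Fin 3) ℝ

/-! ### A Lipschitz constant for the smooth transition -/

section Transition

/-- The derivative of Mathlib's smooth transition vanishes off `[0, 1]` (it is constant there). [folklore] -/
theorem deriv_smoothTransition_eq_zero {x : ℝ} (hx : x < 0 ∨ 1 < x) :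
    deriv Real.smoothTransition x = 0 := by
  rcases hx with hx | hx
  · have h : Real.smoothTransition =ᶠ[𝓝 x] fun _ ↦ (0 : ℝ) :=
      (eventually_lt_nhds hx).mono fun y hy ↦ Real.smoothTransition.zero_of_nonpos hy.le
    rw [h.deriv_eq, deriv_const]
  · have h : Real.smoothTransition =ᶠ[𝓝 x] fun _ ↦ (1 : ℝ) :=
      (eventually_gt_nhds hx).mono fun y hy ↦ Real.smoothTransition.one_of_one_le hy.le
    rw [h.deriv_eq, deriv_const]

/-- **The smooth transition is globally Lipschitz**: its derivative is continuous and vanishes off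
the compact `[0, 1]`. [folklore] -/
theorem exists_lipschitz_smoothTransition :
    ∃ C : ℝ, 0 < C ∧ ∀ x y : ℝ, |Real.smoothTransition x - Real.smoothTransition y| ≤ C * |x - y| := by
  have hd : Continuous (deriv Real.smoothTransition) :=
    (Real.smoothTransition.contDiff (n := 1)).continuous_deriv le_rfl
  obtain ⟨C₀, hC₀⟩ := isCompact_Icc.exists_bound_of_continuousOn (s := Icc (0 : ℝ) 1) hd.continuousOn
  refine ⟨max C₀ 1, lt_max_of_lt_right one_pos, fun x y ↦ ?_⟩
  have hb : ∀ z ∈ (univ : Set ℝ), ‖deriv Real.smoothTransition z‖ ≤ max C₀ 1 := by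
    intro z _
    by_cases hz : z ∈ Icc (0 : ℝ) 1
    · exact (hC₀ z hz).trans (le_max_left _ _)
    · rw [mem_Icc, not_and_or, not_le, not_le] at hz
      rw [deriv_smoothTransition_eq_zero hz, norm_zero]
      exact le_trans zero_le_one (le_max_right _ _)
  have h := Convex.norm_image_sub_le_of_norm_deriv_le (𝕜 := ℝ) (f := Real.smoothTransition)
    (fun z _ ↦ (Real.smoothTransition.contDiff (n := 1)).contDiffAt.differentiableAt one_ne_zero) hb
    convex_univ (mem_univ y) (mem_univ x)
  simpa [Real.norm_eq_abs] using h

/-- **A Lipschitz constant `C_σ > 0` of the smooth transition.** [folklore] -/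
def transitionLip : ℝ := exists_lipschitz_smoothTransition.choose

/-- `C_σ > 0`. [folklore] -/
theorem transitionLip_pos : 0 < transitionLip := exists_lipschitz_smoothTransition.choose_spec.1

/-- `|σ x - σ y| ≤ C_σ |x - y|`. [folklore] -/
theorem abs_smoothTransition_sub_le (x y : ℝ) :
    |Real.smoothTransition x - Real.smoothTransition y| ≤ transitionLip * |x - y| :=
  exists_lipschitz_smoothTransition.choose_spec.2 x y

end Transition

/-! ### The logarithmic cut-off -/

section Cutoff

variable {ρ L : ℝ}

/-- **The logarithmic cut-off** `χ(v) = σ(1 + (log ρ - log max(‖v‖, ρ/2)) / L)`: equal to `1` on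
the ball `‖v‖ ≤ ρ`, to `0` off the ball `‖v‖ < ρ e^L`, a non-increasing function of `‖v‖` whose
slope in `log ‖v‖` is at most `C_σ / L`. [folklore] -/
def logRadialCutoff (ρ L : ℝ) (v : 𝔼 3) : ℝ :=
  Real.smoothTransition (1 + (Real.log ρ - Real.log (max ‖v‖ (ρ / 2))) / L)

/-- `0 ≤ χ`. [folklore] -/
theorem logRadialCutoff_nonneg (v : 𝔼 3) : 0 ≤ logRadialCutoff ρ L v := Real.smoothTransition.nonneg _

/-- `χ ≤ 1`. [folklore] -/
theorem logRadialCutoff_le_one (v : 𝔼 3) : logRadialCutoff ρ L v ≤ 1 := Real.smoothTransition.le_one _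

/-- **`χ = 1` on the ball of radius `ρ`.** [folklore] -/
theorem logRadialCutoff_eq_one (hρ : 0 < ρ) (hL : 0 < L) {v : 𝔼 3} (hv : ‖v‖ ≤ ρ) :
    logRadialCutoff ρ L v = 1 := by
  refine Real.smoothTransition.one_of_one_le ?_
  have hm : max ‖v‖ (ρ / 2) ≤ ρ := max_le hv (by linarith)
  have hm0 : 0 < max ‖v‖ (ρ / 2) := lt_max_of_lt_right (by linarith)
  have hlog : Real.log (max ‖v‖ (ρ / 2)) ≤ Real.log ρ := Real.log_le_log hm0 hm
  have : 0 ≤ (Real.log ρ - Real.log (max ‖v‖ (ρ / 2))) / L := div_nonneg (by linarith) hL.le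
  linarith

/-- **`χ = 0` off the ball of radius `ρ e^L`.** [folklore] -/
theorem logRadialCutoff_eq_zero (hρ : 0 < ρ) (hL : 0 < L) {v : 𝔼 3} (hv : ρ * Real.exp L ≤ ‖v‖) :
    logRadialCutoff ρ L v = 0 := by
  refine Real.smoothTransition.zero_of_nonpos ?_
  have h1 : ρ ≤ ρ * Real.exp L := le_mul_of_one_le_right hρ.le (Real.one_le_exp hL.le)
  have hm : max ‖v‖ (ρ / 2) = ‖v‖ := max_eq_left (by linarith)
  rw [hm]
  have hv0 : 0 < ‖v‖ := lt_of_lt_of_le (mul_pos hρ (Real.exp_pos L)) hv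
  have hlog : Real.log ρ + L ≤ Real.log ‖v‖ := by
    have := Real.log_le_log (mul_pos hρ (Real.exp_pos L)) hv
    rwa [Real.log_mul hρ.ne' (Real.exp_pos L).ne', Real.log_exp] at this
  have : (Real.log ρ - Real.log ‖v‖) / L ≤ -1 := by
    rw [div_le_iff₀ hL]; linarith
  linarith

/-- **`χ` is a non-increasing function of the norm.** [folklore] -/
theorem logRadialCutoff_antitone (hρ : 0 < ρ) (hL : 0 < L) {v w : 𝔼 3} (h : ‖v‖ ≤ ‖w‖) :
    logRadialCutoff ρ L w ≤ logRadialCutoff ρ L v := by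
  refine Real.smoothTransition.monotone ?_
  have hm0 : 0 < max ‖v‖ (ρ / 2) := lt_max_of_lt_right (by linarith)
  have hm : max ‖v‖ (ρ / 2) ≤ max ‖w‖ (ρ / 2) := max_le_max_right _ h
  have hlog := Real.log_le_log hm0 hm
  have : (Real.log ρ - Real.log (max ‖w‖ (ρ / 2))) / L ≤
      (Real.log ρ - Real.log (max ‖v‖ (ρ / 2))) / L :=
    div_le_div_of_nonneg_right (by linarith) hL.le
  linarith

/-- `χ` depends only on the norm. [folklore] -/
theorem logRadialCutoff_eq_of_norm_eq {v w : 𝔼 3} (h : ‖v‖ = ‖w‖) : logRadialCutoff ρ L v = logRadialCutoff ρ L w := by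
  simp only [logRadialCutoff, h]

/-- **The logarithmic slope estimate**: for `0 < ‖v‖ ≤ ‖w‖`,
`χ v - χ w ≤ (C_σ / L) (‖w‖ - ‖v‖) / ‖v‖` (Lipschitz bound for `σ`, then
`log r_w - log r_v ≤ (r_w - r_v)/r_v ≤ (‖w‖ - ‖v‖)/‖v‖` for `r = max(‖·‖, ρ/2)`). [folklore] -/
theorem logRadialCutoff_sub_le (hρ : 0 < ρ) (hL : 0 < L) {v w : 𝔼 3} (hv : v ≠ 0) (h : ‖v‖ ≤ ‖w‖) :
    logRadialCutoff ρ L v - logRadialCutoff ρ L w ≤ transitionLip / L * ((‖w‖ - ‖v‖) / ‖v‖) := by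
  have hv0 : 0 < ‖v‖ := norm_pos_iff.2 hv
  set rv := max ‖v‖ (ρ / 2) with hrv
  set rw := max ‖w‖ (ρ / 2) with hrw
  have hrv0 : 0 < rv := lt_max_of_lt_right (by linarith)
  have hrvw : rv ≤ rw := max_le_max_right _ h
  have hrv_ge : ‖v‖ ≤ rv := le_max_left _ _
  have hdiff : rw - rv ≤ ‖w‖ - ‖v‖ := by
    simp only [hrv, hrw]
    rcases le_total ‖w‖ (ρ / 2) with hw | hw
    · rw [max_eq_right hw, max_eq_right (h.trans hw)]; linarith
    · rw [max_eq_left hw]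
      have := le_max_left ‖v‖ (ρ / 2)
      linarith [le_max_right ‖v‖ (ρ / 2)]
  have hlog : Real.log rw - Real.log rv ≤ (rw - rv) / rv := by
    have h1 : Real.log (rw / rv) ≤ rw / rv - 1 := Real.log_le_sub_one_of_pos (div_pos (hrv0.trans_le hrvw) hrv0)
    rw [Real.log_div (hrv0.trans_le hrvw).ne' hrv0.ne'] at h1
    rwa [div_sub_one hrv0.ne'] at h1
  have hfrac : (rw - rv) / rv ≤ (‖w‖ - ‖v‖) / ‖v‖ :=
    calc (rw - rv) / rv ≤ (‖w‖ - ‖v‖) / rv := div_le_div_of_nonneg_right hdiff hrv0.le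
      _ ≤ (‖w‖ - ‖v‖) / ‖v‖ := div_le_div_of_nonneg_left (by linarith) hv0 hrv_ge
  have hlip := abs_smoothTransition_sub_le (1 + (Real.log ρ - Real.log rv) / L)
    (1 + (Real.log ρ - Real.log rw) / L)
  have hx : (1 + (Real.log ρ - Real.log rv) / L) - (1 + (Real.log ρ - Real.log rw) / L) =
      (Real.log rw - Real.log rv) / L := by ring
  rw [hx, abs_of_nonneg (div_nonneg (by linarith [Real.log_le_log hrv0 hrvw]) hL.le)] at hlip
  have hC := transitionLip_pos
  calc logRadialCutoff ρ L v - logRadialCutoff ρ L w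
      ≤ |logRadialCutoff ρ L v - logRadialCutoff ρ L w| := le_abs_self _
    _ ≤ transitionLip * ((Real.log rw - Real.log rv) / L) := hlip
    _ ≤ transitionLip * (((‖w‖ - ‖v‖) / ‖v‖) / L) := by
        refine mul_le_mul_of_nonneg_left (div_le_div_of_nonneg_right (hlog.trans hfrac) hL.le) hC.le
    _ = transitionLip / L * ((‖w‖ - ‖v‖) / ‖v‖) := by ring

/-- **`χ` is smooth** (it is constant `1` near the ball `‖v‖ < ρ`, and a composition of smooth maps
where `‖v‖ > ρ/2`). [folklore] -/
theorem contDiff_logRadialCutoff (hρ : 0 < ρ) (hL : 0 < L) : ContDiff ℝ ∞ (logRadialCutoff ρ L) := by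
  refine contDiff_iff_contDiffAt.2 fun v ↦ ?_
  by_cases hv : ‖v‖ < ρ
  · -- constant near `v`
    have h : logRadialCutoff ρ L =ᶠ[𝓝 v] fun _ ↦ (1 : ℝ) := by
      filter_upwards [(continuous_norm.isOpen_preimage _ isOpen_Iio).mem_nhds (by simpa using hv)]
        with w hw
      exact logRadialCutoff_eq_one hρ hL (le_of_lt hw)
    exact contDiffAt_const.congr_of_eventuallyEq h
  · -- `‖·‖ > ρ / 2` near `v`, where the `max` is the norm
    have hv2 : ρ / 2 < ‖v‖ := by linarith [not_lt.1 hv]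
    have hne : v ≠ 0 := by
      intro h0; rw [h0, norm_zero] at hv2; linarith
    have h : logRadialCutoff ρ L =ᶠ[𝓝 v] fun w ↦
        Real.smoothTransition (1 + (Real.log ρ - Real.log ‖w‖) / L) := by
      filter_upwards [(continuous_norm.isOpen_preimage _ isOpen_Ioi).mem_nhds (by simpa using hv2)]
        with w hw
      simp only [logRadialCutoff, max_eq_left (le_of_lt (by simpa using hw))]
    refine ContDiffAt.congr_of_eventuallyEq ?_ h
    have h1 : ContDiffAt ℝ ∞ (fun w : 𝔼 3 ↦ ‖w‖) v := contDiffAt_norm ℝ hne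
    have h2 : ContDiffAt ℝ ∞ (fun w : 𝔼 3 ↦ Real.log ‖w‖) v := h1.log (norm_pos_iff.2 hne).ne'
    exact Real.smoothTransition.contDiff.contDiffAt.comp v
      (contDiffAt_const.add ((contDiffAt_const.sub h2).div_const _))

end Cutoff

/-! ### Uniform bounds for a smooth matrix path -/

section Bounds

/-- A continuous real function which is bounded on `[0, 1]` by compactness and takes on the two
half-lines only values it takes at `0` or `1` is bounded. [folklore] -/
theorem exists_bound_of_ends {f : ℝ → ℝ} (hf : Continuous f) (h0 : ∀ θ ≤ 0, f θ = f 0)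
    (h1 : ∀ θ, 1 ≤ θ → f θ = f 1) : ∃ K, 0 ≤ K ∧ ∀ θ, |f θ| ≤ K := by
  obtain ⟨C, hC⟩ := isCompact_Icc.exists_bound_of_continuousOn (hf.continuousOn (s := Icc (0 : ℝ) 1))
  refine ⟨max C 0, le_max_right _ _, fun θ ↦ le_max_of_le_left ?_⟩
  rcases le_or_gt θ 0 with hθ | hθ
  · rw [h0 θ hθ]; simpa using hC 0 ⟨le_rfl, zero_le_one⟩
  rcases le_or_gt 1 θ with hθ' | hθ'
  · rw [h1 θ hθ']; simpa using hC 1 ⟨zero_le_one, le_rfl⟩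
  · simpa using hC θ ⟨hθ.le, hθ'.le⟩

namespace SmoothMatrixPath

variable {N : 𝕄} (Q : SmoothMatrixPath N)

/-- Past `1` the inverse path is constant (uniqueness of inverses of the constant `Q = N`). [folklore] -/
theorem inv_eq_inv_one {θ : ℝ} (hθ : 1 ≤ θ) : Q.inv θ = Q.inv 1 := by
  have h1 : Q.toFun θ = Q.toFun 1 := by rw [Q.eq_self θ hθ, Q.eq_self 1 le_rfl]
  calc Q.inv θ = Q.inv θ * (Q.toFun 1 * Q.inv 1) := by rw [Q.mul_inv, Matrix.mul_one]
    _ = (Q.inv θ * Q.toFun θ) * Q.inv 1 := by rw [← h1, Matrix.mul_assoc]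
    _ = Q.inv 1 := by rw [Q.inv_mul, Matrix.one_mul]

/-- **The entries of the inverse path are uniformly bounded.** [folklore] -/
theorem exists_bound_inv : ∃ K, 0 ≤ K ∧ ∀ θ i j, |Q.inv θ i j| ≤ K := by
  have h : ∀ i j, ∃ K, 0 ≤ K ∧ ∀ θ, |Q.inv θ i j| ≤ K := fun i j ↦
    exists_bound_of_ends (Q.contDiff_inv_apply i j).continuous
      (fun θ hθ ↦ by rw [Q.inv_eq_one hθ, Q.inv_eq_one le_rfl])
      (fun θ hθ ↦ by rw [Q.inv_eq_inv_one hθ])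
  choose K hK0 hK using h
  refine ⟨∑ i, ∑ j, K i j, Finset.sum_nonneg fun i _ ↦ Finset.sum_nonneg fun j _ ↦ hK0 i j,
    fun θ i j ↦ (hK i j θ).trans ?_⟩
  calc K i j ≤ ∑ j', K i j' :=
        Finset.single_le_sum (f := fun j' ↦ K i j') (fun j' _ ↦ hK0 i j') (Finset.mem_univ j)
    _ ≤ ∑ i', ∑ j', K i' j' :=
        Finset.single_le_sum (f := fun i' ↦ ∑ j', K i' j') (fun i' _ ↦
          Finset.sum_nonneg fun j' _ ↦ hK0 i' j') (Finset.mem_univ i)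

/-- The derivative of an entry of the path vanishes off `[0, 1]` (the path is constant there). [folklore] -/
theorem deriv_apply_eq_zero (i j : Fin 3) {θ : ℝ} (hθ : θ < 0 ∨ 1 < θ) :
    deriv (fun θ ↦ Q.toFun θ i j) θ = 0 := by
  rcases hθ with hθ | hθ
  · have h : (fun θ ↦ Q.toFun θ i j) =ᶠ[𝓝 θ] fun _ ↦ (1 : 𝕄) i j :=
      (eventually_lt_nhds hθ).mono fun y hy ↦ by
        change Q.toFun y i j = (1 : 𝕄) i j; rw [Q.eq_one y hy.le]
    rw [h.deriv_eq, deriv_const]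
  · have h : (fun θ ↦ Q.toFun θ i j) =ᶠ[𝓝 θ] fun _ ↦ N i j :=
      (eventually_gt_nhds hθ).mono fun y hy ↦ by
        change Q.toFun y i j = N i j; rw [Q.eq_self y hy.le]
    rw [h.deriv_eq, deriv_const]

/-- **The entries of a smooth matrix path are globally Lipschitz** (the derivative is continuous
and vanishes off `[0, 1]`). [folklore] -/
theorem exists_lip : ∃ K', 0 ≤ K' ∧ ∀ i j a b, |Q.toFun a i j - Q.toFun b i j| ≤ K' * |a - b| := by
  have h : ∀ i j, ∃ C, 0 ≤ C ∧ ∀ a b, |Q.toFun a i j - Q.toFun b i j| ≤ C * |a - b| := by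
    intro i j
    have h1 : ContDiff ℝ 1 fun θ ↦ Q.toFun θ i j :=
      (Q.contDiff_apply i j).of_le (by exact_mod_cast (le_top : (1 : ℕ∞) ≤ ⊤))
    have hd : Continuous (deriv fun θ ↦ Q.toFun θ i j) := h1.continuous_deriv le_rfl
    obtain ⟨C₀, hC₀⟩ := isCompact_Icc.exists_bound_of_continuousOn (s := Icc (0 : ℝ) 1) hd.continuousOn
    refine ⟨max C₀ 0, le_max_right _ _, fun a b ↦ ?_⟩
    have hb : ∀ z ∈ (univ : Set ℝ), ‖deriv (fun θ ↦ Q.toFun θ i j) z‖ ≤ max C₀ 0 := by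
      intro z _
      by_cases hz : z ∈ Icc (0 : ℝ) 1
      · exact (hC₀ z hz).trans (le_max_left _ _)
      · rw [mem_Icc, not_and_or, not_le, not_le] at hz
        rw [Q.deriv_apply_eq_zero i j hz, norm_zero]
        exact le_max_right _ _
    have h := Convex.norm_image_sub_le_of_norm_deriv_le (𝕜 := ℝ) (f := fun θ ↦ Q.toFun θ i j)
      (fun z _ ↦ h1.contDiffAt.differentiableAt one_ne_zero) hb convex_univ (mem_univ b) (mem_univ a)
    simpa [Real.norm_eq_abs] using h
  choose C hC0 hC using h
  refine ⟨∑ i, ∑ j, C i j, Finset.sum_nonneg fun i _ ↦ Finset.sum_nonneg fun j _ ↦ hC0 i j,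
    fun i j a b ↦ (hC i j a b).trans (mul_le_mul_of_nonneg_right ?_ (abs_nonneg _))⟩
  calc C i j ≤ ∑ j', C i j' :=
        Finset.single_le_sum (f := fun j' ↦ C i j') (fun j' _ ↦ hC0 i j') (Finset.mem_univ j)
    _ ≤ ∑ i', ∑ j', C i' j' :=
        Finset.single_le_sum (f := fun i' ↦ ∑ j', C i' j') (fun i' _ ↦
          Finset.sum_nonneg fun j' _ ↦ hC0 i' j') (Finset.mem_univ i)

/-- **A common bound `K ≥ 1` for the entries of `Q` and of `Q⁻¹`.** [folklore] -/
def entryBound : ℝ := max (max Q.exists_bound.choose Q.exists_bound_inv.choose) 1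

/-- `1 ≤ K`. [folklore] -/
theorem one_le_entryBound : 1 ≤ Q.entryBound := le_max_right _ _

/-- `0 < K`. [folklore] -/
theorem entryBound_pos : 0 < Q.entryBound := lt_of_lt_of_le one_pos Q.one_le_entryBound

/-- `|Q θ i j| ≤ K`. [folklore] -/
theorem abs_toFun_le (θ : ℝ) (i j : Fin 3) : |Q.toFun θ i j| ≤ Q.entryBound :=
  (Q.exists_bound.choose_spec.2 θ i j).trans ((le_max_left _ _).trans (le_max_left _ _))

/-- `|Q⁻¹ θ i j| ≤ K`. [folklore] -/
theorem abs_inv_le (θ : ℝ) (i j : Fin 3) : |Q.inv θ i j| ≤ Q.entryBound :=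
  (Q.exists_bound_inv.choose_spec.2 θ i j).trans ((le_max_right _ _).trans (le_max_left _ _))

/-- **A Lipschitz constant `K' ≥ 0` for the entries of `Q`.** [folklore] -/
def lipBound : ℝ := Q.exists_lip.choose

/-- `0 ≤ K'`. [folklore] -/
theorem lipBound_nonneg : 0 ≤ Q.lipBound := Q.exists_lip.choose_spec.1

/-- `|Q a i j - Q b i j| ≤ K' |a - b|`. [folklore] -/
theorem abs_toFun_sub_le (i j : Fin 3) (a b : ℝ) :
    |Q.toFun a i j - Q.toFun b i j| ≤ Q.lipBound * |a - b| :=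
  Q.exists_lip.choose_spec.2 i j a b

end SmoothMatrixPath

/-- **Norm bound for the action of a matrix with bounded entries**: `‖M v‖ ≤ 9 K ‖v‖`. [folklore] -/
theorem norm_mulVecE_le {M : 𝕄} {K : ℝ} (hK : ∀ i j, |M i j| ≤ K) (v : 𝔼 3) :
    ‖mulVecE M v‖ ≤ 9 * K * ‖v‖ :=
  calc ‖mulVecE M v‖ ≤ ∑ i, |mulVecE M v i| := norm_le_sum_abs _
    _ ≤ ∑ _i : Fin 3, 3 * K * ‖v‖ := Finset.sum_le_sum fun i _ ↦ by
        have := abs_mulVecE_apply_le (m := 3) hK v i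
        exact_mod_cast this
    _ = 9 * K * ‖v‖ := by simp only [Finset.sum_const, Finset.card_univ, Fintype.card_fin,
        nsmul_eq_mul, Nat.cast_ofNat]; ring

/-- `mulVecE` is additive in the matrix: differences. [folklore] -/
theorem mulVecE_sub (A B : 𝕄) (v : 𝔼 3) : mulVecE (A - B) v = mulVecE A v - mulVecE B v := by
  rw [← matCLM_apply, ← matCLM_apply, ← matCLM_apply, matCLM_sub]; rfl

/-- `mulVecE` is linear in the vector: differences. [folklore] -/
theorem mulVecE_sub_right (A : 𝕄) (v w : 𝔼 3) : mulVecE A (v - w) = mulVecE A v - mulVecE A w := by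
  rw [← matCLM_apply, ← matCLM_apply, ← matCLM_apply, map_sub]

end Bounds

/-! ### The radial linearization -/

section Radial

variable {N : 𝕄} (Q : SmoothMatrixPath N) (ρ L : ℝ)

/-- **The radial linearization** `Φ_s(v) = Q(σ(s) χ(v)) v` of the path `Q` at scale `(ρ, L)`. [cite: GompfAGT2010, §4 ¶2 (an isotopy rel p straightening the linear monodromy near 0)] -/
def radialLinMap (s : ℝ) (v : 𝔼 3) : 𝔼 3 :=
  mulVecE (Q.toFun (Real.smoothTransition s * logRadialCutoff ρ L v)) v

variable {ρ L}

/-- **On the ball of radius `ρ` the radial linearization is the linear map `Q(σ s)`.** [cite: GompfAGT2010, Def. 4.1 and §4 ¶2] -/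
theorem radialLinMap_of_norm_le (hρ : 0 < ρ) (hL : 0 < L) (s : ℝ) {v : 𝔼 3} (hv : ‖v‖ ≤ ρ) :
    radialLinMap Q ρ L s v = mulVecE (Q.toFun (Real.smoothTransition s)) v := by
  rw [radialLinMap, logRadialCutoff_eq_one hρ hL hv, mul_one]

/-- **Off the ball of radius `ρ e^L` the radial linearization is the identity.** [folklore] -/
theorem radialLinMap_of_le_norm (hρ : 0 < ρ) (hL : 0 < L) (s : ℝ) {v : 𝔼 3}
    (hv : ρ * Real.exp L ≤ ‖v‖) : radialLinMap Q ρ L s v = v := by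
  rw [radialLinMap, logRadialCutoff_eq_zero hρ hL hv, mul_zero, Q.eq_one 0 le_rfl, mulVecE_one]

/-- The origin is fixed. [folklore] -/
@[simp] theorem radialLinMap_zero (s : ℝ) : radialLinMap Q ρ L s 0 = 0 := by
  rw [radialLinMap, mulVecE_zero]

/-- For `s ≤ 0` the radial linearization is the identity. [folklore] -/
theorem radialLinMap_of_nonpos {s : ℝ} (hs : s ≤ 0) (v : 𝔼 3) : radialLinMap Q ρ L s v = v := by
  rw [radialLinMap, Real.smoothTransition.zero_of_nonpos hs, zero_mul, Q.eq_one 0 le_rfl, mulVecE_one]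

/-- **Rays go to the cone of the path**: `Φ_s (θ u) = θ Q(σ(s) χ(θ u)) u`. [cite: GompfAGT2010, §4 ¶3 (each straightening keeps φ(α) within T)] -/
theorem radialLinMap_smul (s θ : ℝ) (u : 𝔼 3) :
    radialLinMap Q ρ L s (θ • u) =
      θ • mulVecE (Q.toFun (Real.smoothTransition s * logRadialCutoff ρ L (θ • u))) u := by
  rw [radialLinMap, mulVecE_smul]

/-- **Joint smoothness** of `(s, v) ↦ Φ_s(v)`. [folklore] -/
theorem contDiff_radialLinMap (hρ : 0 < ρ) (hL : 0 < L) :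
    ContDiff ℝ ∞ fun p : ℝ × 𝔼 3 ↦ radialLinMap Q ρ L p.1 p.2 := by
  have h1 : ContDiff ℝ ∞ fun p : ℝ × 𝔼 3 ↦
      (Real.smoothTransition p.1 * logRadialCutoff ρ L p.2, p.2) :=
    ((Real.smoothTransition.contDiff.comp contDiff_fst).mul
      ((contDiff_logRadialCutoff hρ hL).comp contDiff_snd)).prodMk contDiff_snd
  exact (contDiff_mulVecE Q.contDiff_apply).comp h1

/-- The difference `Φ_s(v) - v` is controlled by the cut-off: `‖Φ_s v - v‖ ≤ 9 K' χ(v) ‖v‖`. [folklore] -/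
theorem norm_radialLinMap_sub_le (s : ℝ) (v : 𝔼 3) :
    ‖radialLinMap Q ρ L s v - v‖ ≤ 9 * Q.lipBound * logRadialCutoff ρ L v * ‖v‖ := by
  have hσ0 := Real.smoothTransition.nonneg s
  have hσ1 := Real.smoothTransition.le_one s
  have hχ0 := logRadialCutoff_nonneg (ρ := ρ) (L := L) v
  have h : radialLinMap Q ρ L s v - v =
      mulVecE (Q.toFun (Real.smoothTransition s * logRadialCutoff ρ L v) - Q.toFun 0) v := by
    rw [mulVecE_sub, Q.eq_one 0 le_rfl, mulVecE_one, radialLinMap]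
  rw [h]
  have hK : ∀ i j, |(Q.toFun (Real.smoothTransition s * logRadialCutoff ρ L v) - Q.toFun 0) i j| ≤
      Q.lipBound * logRadialCutoff ρ L v := fun i j ↦ by
    rw [Matrix.sub_apply]
    refine (Q.abs_toFun_sub_le i j _ _).trans ?_
    rw [sub_zero, abs_of_nonneg (mul_nonneg hσ0 hχ0)]
    exact mul_le_mul_of_nonneg_left (mul_le_of_le_one_left hχ0 hσ1) Q.lipBound_nonneg
  calc ‖mulVecE _ v‖ ≤ 9 * (Q.lipBound * logRadialCutoff ρ L v) * ‖v‖ := norm_mulVecE_le hK v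
    _ = 9 * Q.lipBound * logRadialCutoff ρ L v * ‖v‖ := by ring

/-- **The scale `L₀(Q) = 486 K K' C_σ + 1`** beyond which the radial linearization is a
diffeomorphism onto its image. [folklore] -/
def SmoothMatrixPath.radialScale : ℝ := 486 * Q.entryBound * Q.lipBound * transitionLip + 1

/-- `0 < L₀`. [folklore] -/
theorem SmoothMatrixPath.radialScale_pos : 0 < Q.radialScale := by
  have := mul_nonneg (mul_nonneg (mul_nonneg (by norm_num : (0 : ℝ) ≤ 486) Q.entryBound_pos.le)
    Q.lipBound_nonneg) transitionLip_pos.le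
  unfold SmoothMatrixPath.radialScale; linarith

/-- The key smallness: for `L ≥ L₀`, `27 K K' C_σ / L ≤ 1/18` (and the coarser consequences). [folklore] -/
theorem SmoothMatrixPath.const_div_le (hL : Q.radialScale ≤ L) :
    27 * Q.entryBound * Q.lipBound * transitionLip / L ≤ 1 / 18 := by
  have hpos : 0 < L := Q.radialScale_pos.trans_le hL
  rw [div_le_iff₀ hpos]
  have h0 := mul_nonneg (mul_nonneg Q.entryBound_pos.le Q.lipBound_nonneg) transitionLip_pos.le
  unfold SmoothMatrixPath.radialScale at hL
  nlinarith

/-- **The ball of radius `ρ e^L` is mapped into itself** (compare `Φ_s v` with the fixed sphere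
`‖w‖ = ρ e^L`, where `χ = 0`). [folklore] -/
theorem norm_radialLinMap_lt (hρ : 0 < ρ) (hL : Q.radialScale ≤ L) (s : ℝ) {v : 𝔼 3}
    (hv : ‖v‖ < ρ * Real.exp L) : ‖radialLinMap Q ρ L s v‖ < ρ * Real.exp L := by
  have hLpos : 0 < L := Q.radialScale_pos.trans_le hL
  by_cases hv0 : v = 0
  · subst hv0; rw [radialLinMap_zero, norm_zero]; exact mul_pos hρ (Real.exp_pos L)
  set R := ρ * Real.exp L
  -- a point on the outer sphere
  set w : 𝔼 3 := (R / ‖v‖) • v with hw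
  have hvn : 0 < ‖v‖ := norm_pos_iff.2 hv0
  have hwn : ‖w‖ = R := by
    rw [hw, norm_smul, Real.norm_eq_abs, abs_of_pos (div_pos (mul_pos hρ (Real.exp_pos L)) hvn),
      div_mul_cancel₀ _ hvn.ne']
  have hχw : logRadialCutoff ρ L w = 0 := logRadialCutoff_eq_zero hρ hLpos (by rw [hwn])
  have hχ : logRadialCutoff ρ L v ≤ transitionLip / L * ((R - ‖v‖) / ‖v‖) := by
    have := logRadialCutoff_sub_le hρ hLpos hv0 (by rw [hwn]; exact hv.le)
    rwa [hχw, sub_zero, hwn] at this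
  have h1 := norm_radialLinMap_sub_le Q s v (ρ := ρ) (L := L)
  have hK' := Q.lipBound_nonneg
  have hK := Q.one_le_entryBound
  have hC := transitionLip_pos
  have hsmall := Q.const_div_le hL
  -- `9 K' C_σ / L ≤ 27 K K' C_σ / L ≤ 1/18 < 1`
  have h9 : 9 * Q.lipBound * (transitionLip / L) ≤ 1 / 18 := by
    calc 9 * Q.lipBound * (transitionLip / L) ≤ 27 * Q.entryBound * Q.lipBound * transitionLip / L := by
          rw [mul_div_assoc]
          have : 9 * Q.lipBound ≤ 27 * Q.entryBound * Q.lipBound := by nlinarith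
          exact mul_le_mul_of_nonneg_right this (div_nonneg hC.le hLpos.le)
      _ ≤ 1 / 18 := hsmall
  have hRv : 0 ≤ R - ‖v‖ := by linarith
  calc ‖radialLinMap Q ρ L s v‖ ≤ ‖v‖ + ‖radialLinMap Q ρ L s v - v‖ := by
        have := norm_add_le v (radialLinMap Q ρ L s v - v)
        rwa [add_sub_cancel] at this
    _ ≤ ‖v‖ + 9 * Q.lipBound * (transitionLip / L * ((R - ‖v‖) / ‖v‖)) * ‖v‖ := by
        have := mul_le_mul_of_nonneg_right
          (mul_le_mul_of_nonneg_left hχ (by positivity : (0 : ℝ) ≤ 9 * Q.lipBound)) hvn.le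
        linarith
    _ = ‖v‖ + (9 * Q.lipBound * (transitionLip / L)) * (R - ‖v‖) := by
        field_simp
    _ ≤ ‖v‖ + (1 / 18) * (R - ‖v‖) := by nlinarith
    _ < R := by
        have : ‖v‖ < R := hv
        nlinarith

/-- `Q⁻¹(b) (Q(b) w) = w`, in `mulVecE` form. [folklore] -/
theorem mulVecE_inv_mulVecE (b : ℝ) (w : 𝔼 3) :
    mulVecE (Q.inv b) (mulVecE (Q.toFun b) w) = w := by
  rw [mulVecE_mulVecE, Q.inv_mul, mulVecE_one]

/-- The injectivity estimate, for `‖v‖ ≤ ‖w‖`. [folklore] -/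
theorem radialLinMap_inj_aux (hρ : 0 < ρ) (hL : Q.radialScale ≤ L) (s : ℝ) {v w : 𝔼 3}
    (h : radialLinMap Q ρ L s v = radialLinMap Q ρ L s w) (hvw : ‖v‖ ≤ ‖w‖) : v = w := by
  have hLpos : 0 < L := Q.radialScale_pos.trans_le hL
  set a := Real.smoothTransition s * logRadialCutoff ρ L v with ha
  set b := Real.smoothTransition s * logRadialCutoff ρ L w with hb
  -- `w = Q⁻¹(b) Q(a) v`
  have hw : w = mulVecE (Q.inv b) (mulVecE (Q.toFun a) v) := by
    have := congrArg (mulVecE (Q.inv b)) h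
    rw [radialLinMap, radialLinMap, mulVecE_inv_mulVecE Q] at this
    exact this.symm
  by_cases hv0 : v = 0
  · subst hv0
    rw [mulVecE_zero, mulVecE_zero] at hw
    exact hw.symm
  have hvn : 0 < ‖v‖ := norm_pos_iff.2 hv0
  have hσ0 := Real.smoothTransition.nonneg s
  have hσ1 := Real.smoothTransition.le_one s
  have hχ : logRadialCutoff ρ L w ≤ logRadialCutoff ρ L v := logRadialCutoff_antitone hρ hLpos hvw
  have hab : 0 ≤ a - b := by rw [ha, hb, ← mul_sub]; exact mul_nonneg hσ0 (sub_nonneg.2 hχ)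
  have hab' : a - b ≤ logRadialCutoff ρ L v - logRadialCutoff ρ L w := by
    rw [ha, hb, ← mul_sub]; exact mul_le_of_le_one_left (sub_nonneg.2 hχ) hσ1
  -- `w - v = Q⁻¹(b) (Q(a) - Q(b)) v`
  have hdiff : w - v = mulVecE (Q.inv b * (Q.toFun a - Q.toFun b)) v := by
    rw [Matrix.mul_sub, mulVecE_sub, ← mulVecE_mulVecE, ← mulVecE_mulVecE, mulVecE_inv_mulVecE Q,
      ← hw]
  have hK : ∀ i j, |(Q.inv b * (Q.toFun a - Q.toFun b)) i j| ≤
      3 * Q.entryBound * (Q.lipBound * (a - b)) := fun i j ↦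
    abs_mul_apply_le (fun i j ↦ Q.abs_inv_le b i j) (fun i j ↦ by
      rw [Matrix.sub_apply]
      have := Q.abs_toFun_sub_le i j a b
      rwa [abs_of_nonneg hab] at this) i j
  have hnorm : ‖w - v‖ ≤ 27 * Q.entryBound * Q.lipBound * (a - b) * ‖v‖ := by
    rw [hdiff]
    refine (norm_mulVecE_le hK v).trans (le_of_eq ?_)
    ring
  have hslope := logRadialCutoff_sub_le hρ hLpos hv0 hvw
  have hsmall := Q.const_div_le hL
  have hKK := mul_nonneg (mul_nonneg Q.entryBound_pos.le Q.lipBound_nonneg) transitionLip_pos.le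
  -- `‖w‖ - ‖v‖ ≤ (27 K K' C_σ / L) (‖w‖ - ‖v‖) ≤ (‖w‖ - ‖v‖) / 18`
  have hkey : ‖w‖ - ‖v‖ ≤ (1 / 18) * (‖w‖ - ‖v‖) := by
    have h1 : ‖w‖ - ‖v‖ ≤ ‖w - v‖ := by
      have := norm_sub_norm_le w v; linarith [abs_sub_comm ‖w‖ ‖v‖]
    have h2 : 27 * Q.entryBound * Q.lipBound * (a - b) * ‖v‖ ≤
        27 * Q.entryBound * Q.lipBound * (transitionLip / L * ((‖w‖ - ‖v‖) / ‖v‖)) * ‖v‖ := by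
      refine mul_le_mul_of_nonneg_right (mul_le_mul_of_nonneg_left (hab'.trans hslope) ?_) hvn.le
      exact mul_nonneg (mul_nonneg (by norm_num) Q.entryBound_pos.le) Q.lipBound_nonneg
    have h3 : 27 * Q.entryBound * Q.lipBound * (transitionLip / L * ((‖w‖ - ‖v‖) / ‖v‖)) * ‖v‖ =
        (27 * Q.entryBound * Q.lipBound * transitionLip / L) * (‖w‖ - ‖v‖) := by
      field_simp
    have h4 : (27 * Q.entryBound * Q.lipBound * transitionLip / L) * (‖w‖ - ‖v‖) ≤
        (1 / 18) * (‖w‖ - ‖v‖) := mul_le_mul_of_nonneg_right hsmall (sub_nonneg.2 hvw)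
    linarith
  have heq : ‖w‖ = ‖v‖ := by linarith
  have hχeq : logRadialCutoff ρ L v = logRadialCutoff ρ L w := logRadialCutoff_eq_of_norm_eq heq.symm
  have hab0 : a = b := by rw [ha, hb, hχeq]
  rw [hw, hab0, mulVecE_inv_mulVecE Q]

/-- **The radial linearization is injective** for `L ≥ L₀(Q)`. [folklore] -/
theorem radialLinMap_injective (hρ : 0 < ρ) (hL : Q.radialScale ≤ L) (s : ℝ) :
    Injective (radialLinMap Q ρ L s) := fun v w h ↦ by
  rcases le_total ‖v‖ ‖w‖ with hvw | hvw
  · exact radialLinMap_inj_aux Q hρ hL s h hvw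
  · exact (radialLinMap_inj_aux Q hρ hL s h.symm hvw).symm

/-! ### The derivative and the local diffeomorphism property -/

/-- The smooth transition is Lipschitz with constant `C_σ` (as a `LipschitzWith` statement). [folklore] -/
theorem lipschitzWith_smoothTransition :
    LipschitzWith (Real.toNNReal transitionLip) Real.smoothTransition :=
  LipschitzWith.of_dist_le_mul fun x y ↦ by
    rw [Real.dist_eq, Real.dist_eq, Real.coe_toNNReal _ transitionLip_pos.le]
    exact abs_smoothTransition_sub_le x y

/-- `|σ'| ≤ C_σ`. [folklore] -/
theorem abs_deriv_smoothTransition_le (y : ℝ) : |deriv Real.smoothTransition y| ≤ transitionLip := by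
  have h := norm_deriv_le_of_lipschitz (x₀ := y) lipschitzWith_smoothTransition
  rwa [Real.norm_eq_abs, Real.coe_toNNReal _ transitionLip_pos.le] at h

/-- Near the inner ball the cut-off has derivative `0`. [folklore] -/
theorem hasFDerivAt_logRadialCutoff_zero (hρ : 0 < ρ) (hL : 0 < L) {v : 𝔼 3} (hv : ‖v‖ < ρ) :
    HasFDerivAt (logRadialCutoff ρ L) (0 : 𝔼 3 →L[ℝ] ℝ) v := by
  have h : (fun _ ↦ (1 : ℝ)) =ᶠ[𝓝 v] logRadialCutoff ρ L := by
    filter_upwards [(continuous_norm.isOpen_preimage _ isOpen_Iio).mem_nhds (by simpa using hv)]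
      with w hw
    exact (logRadialCutoff_eq_one hρ hL (le_of_lt hw)).symm
  exact (hasFDerivAt_const (1 : ℝ) v).congr_of_eventuallyEq h.symm

/-- **The derivative of the cut-off and its bound `‖χ'(v)‖ ≤ C_σ / (L ‖v‖)`** on the zone
`‖v‖ > ρ/2` (chain rule through `‖·‖²`, `log`, an affine map and `σ`). [folklore] -/
theorem exists_hasFDerivAt_logRadialCutoff (hρ : 0 < ρ) (hL : 0 < L) {v : 𝔼 3} (hv : ρ / 2 < ‖v‖) :
    ∃ χ' : 𝔼 3 →L[ℝ] ℝ, HasFDerivAt (logRadialCutoff ρ L) χ' v ∧ ‖χ'‖ ≤ transitionLip / (L * ‖v‖) := by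
  have hvn : 0 < ‖v‖ := lt_trans (by linarith) hv
  have hv0 : v ≠ 0 := norm_pos_iff.1 hvn
  -- the representation on the zone
  set k : 𝔼 3 → ℝ := fun w ↦ (1 + Real.log ρ / L) - 1 / (2 * L) * Real.log (‖w‖ ^ 2) with hk
  have hrep : Real.smoothTransition ∘ k =ᶠ[𝓝 v] logRadialCutoff ρ L := by
    filter_upwards [(continuous_norm.isOpen_preimage _ isOpen_Ioi).mem_nhds (by simpa using hv)]
      with w hw
    have hw' : ρ / 2 < ‖w‖ := by simpa using hw
    simp only [comp_apply, logRadialCutoff, max_eq_left hw'.le, hk, Real.log_pow, Nat.cast_ofNat]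
    congr 1
    field_simp
    ring
  -- derivatives of the pieces
  have h1 : HasFDerivAt (fun w : 𝔼 3 ↦ ‖w‖ ^ 2) ((2 : ℝ) • innerSL ℝ v) v := by
    have h := (hasStrictFDerivAt_norm_sq v).hasFDerivAt
    rwa [← Nat.cast_smul_eq_nsmul ℝ, Nat.cast_ofNat] at h
  have h2 : HasDerivAt Real.log (‖v‖ ^ 2)⁻¹ (‖v‖ ^ 2) := Real.hasDerivAt_log (pow_ne_zero 2 hvn.ne')
  have h12 : HasFDerivAt (fun w : 𝔼 3 ↦ Real.log (‖w‖ ^ 2)) ((‖v‖ ^ 2)⁻¹ • ((2 : ℝ) • innerSL ℝ v)) v := by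
    exact h2.comp_hasFDerivAt v h1
  have hk' : HasFDerivAt k (-((1 / (2 * L)) • ((‖v‖ ^ 2)⁻¹ • ((2 : ℝ) • innerSL ℝ v)))) v :=
    (h12.const_smul (1 / (2 * L))).const_sub (1 + Real.log ρ / L)
  have h3 : HasDerivAt Real.smoothTransition (deriv Real.smoothTransition (k v)) (k v) :=
    ((Real.smoothTransition.contDiff (n := 1)).contDiffAt.differentiableAt one_ne_zero).hasDerivAt
  have hχ := h3.comp_hasFDerivAt v hk'
  refine ⟨_, hχ.congr_of_eventuallyEq hrep.symm, ?_⟩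
  -- the bound
  have hC := abs_deriv_smoothTransition_le (k v)
  have hCpos := transitionLip_pos
  rw [norm_smul, norm_neg, norm_smul, norm_smul, norm_smul, innerSL_apply_norm, Real.norm_eq_abs,
    Real.norm_eq_abs, Real.norm_eq_abs, Real.norm_eq_abs, abs_of_pos (by positivity : (0 : ℝ) < 1 / (2 * L)),
    abs_of_pos (by positivity : (0 : ℝ) < (‖v‖ ^ 2)⁻¹), abs_of_pos (by norm_num : (0 : ℝ) < 2)]
  have heq : 1 / (2 * L) * ((‖v‖ ^ 2)⁻¹ * (2 * ‖v‖)) = 1 / (L * ‖v‖) := by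
    field_simp
  rw [heq]
  calc |deriv Real.smoothTransition (k v)| * (1 / (L * ‖v‖))
      ≤ transitionLip * (1 / (L * ‖v‖)) := mul_le_mul_of_nonneg_right hC (by positivity)
    _ = transitionLip / (L * ‖v‖) := by ring

/-- **At every point the cut-off has a derivative `χ'` with `‖χ'‖ ‖v‖ ≤ C_σ / L`.** [folklore] -/
theorem exists_hasFDerivAt_logRadialCutoff' (hρ : 0 < ρ) (hL : 0 < L) (v : 𝔼 3) :
    ∃ χ' : 𝔼 3 →L[ℝ] ℝ, HasFDerivAt (logRadialCutoff ρ L) χ' v ∧ ‖χ'‖ * ‖v‖ ≤ transitionLip / L := by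
  by_cases hv : ‖v‖ < ρ
  · exact ⟨0, hasFDerivAt_logRadialCutoff_zero hρ hL hv, by
      rw [norm_zero, zero_mul]; exact div_nonneg transitionLip_pos.le hL.le⟩
  · have hv2 : ρ / 2 < ‖v‖ := by linarith [not_lt.1 hv]
    have hvn : 0 < ‖v‖ := lt_trans (by linarith) hv2
    obtain ⟨χ', hχ', hb⟩ := exists_hasFDerivAt_logRadialCutoff hρ hL hv2
    refine ⟨χ', hχ', ?_⟩
    rw [← le_div_iff₀ hvn, div_div]
    exact hb

/-- **The operator path `T(a) = Q(a)` (as operators on `ℝ³`) is `9 K'`-Lipschitz.** [folklore] -/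
theorem norm_matCLM_toFun_sub_le (a b : ℝ) :
    ‖matCLM (Q.toFun a) - matCLM (Q.toFun b)‖ ≤ 9 * Q.lipBound * |a - b| := by
  rw [← matCLM_sub]
  refine ContinuousLinearMap.opNorm_le_bound _ (by positivity [Q.lipBound_nonneg]) fun v ↦ ?_
  rw [matCLM_apply]
  have hK : ∀ i j, |(Q.toFun a - Q.toFun b) i j| ≤ Q.lipBound * |a - b| := fun i j ↦ by
    rw [Matrix.sub_apply]; exact Q.abs_toFun_sub_le i j a b
  calc ‖mulVecE (Q.toFun a - Q.toFun b) v‖ ≤ 9 * (Q.lipBound * |a - b|) * ‖v‖ := norm_mulVecE_le hK v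
    _ = 9 * Q.lipBound * |a - b| * ‖v‖ := by ring

/-- The operator path has derivative of norm at most `9 K'`. [folklore] -/
theorem norm_deriv_matCLM_toFun_le (a : ℝ) :
    ‖deriv (fun a ↦ matCLM (Q.toFun a)) a‖ ≤ 9 * Q.lipBound := by
  have hlip : LipschitzWith (Real.toNNReal (9 * Q.lipBound)) fun a ↦ matCLM (Q.toFun a) :=
    LipschitzWith.of_dist_le_mul fun x y ↦ by
      rw [dist_eq_norm, Real.dist_eq, Real.coe_toNNReal _ (by positivity [Q.lipBound_nonneg])]
      exact norm_matCLM_toFun_sub_le Q x y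
  have h := norm_deriv_le_of_lipschitz (x₀ := a) hlip
  rwa [Real.coe_toNNReal _ (by positivity [Q.lipBound_nonneg])] at h

/-- **The derivative of the radial linearization**: at every `v` there is a continuous linear
`D` with `HasFDerivAt Φ_s D v` of the form `D w = Q(a) w + (m χ'(w)) • T'(v)`, which is
**injective** for `L ≥ L₀(Q)`. [folklore] -/
theorem exists_hasFDerivAt_radialLinMap (hρ : 0 < ρ) (hL : Q.radialScale ≤ L) (s : ℝ) (v : 𝔼 3) :
    ∃ D : 𝔼 3 →L[ℝ] 𝔼 3, HasFDerivAt (radialLinMap Q ρ L s) D v ∧ Injective D := by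
  have hLpos : 0 < L := Q.radialScale_pos.trans_le hL
  set m := Real.smoothTransition s with hm
  obtain ⟨χ', hχ', hχb⟩ := exists_hasFDerivAt_logRadialCutoff' hρ hLpos v
  set T : ℝ → (𝔼 3 →L[ℝ] 𝔼 3) := fun a ↦ matCLM (Q.toFun a) with hT
  set g : 𝔼 3 → ℝ := fun w ↦ m * logRadialCutoff ρ L w with hg
  have hTd : ∀ a, HasDerivAt T (deriv T a) a := fun a ↦
    (((contDiff_matCLM Q.contDiff_apply).differentiable (by simp)).differentiableAt).hasDerivAt
  have hgd : HasFDerivAt g (m • χ') v := hχ'.const_smul m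
  have hcd : HasFDerivAt (fun w ↦ T (g w))
      (((1 : ℝ →L[ℝ] ℝ).smulRight (deriv T (g v))).comp (m • χ')) v :=
    (hTd (g v)).hasFDerivAt.comp v hgd
  have hΦd := hcd.clm_apply (hasFDerivAt_id v)
  have hfun : (fun w ↦ (T (g w)) (id w)) = radialLinMap Q ρ L s := by
    funext w; simp only [hT, hg, id, matCLM_apply]; rfl
  rw [hfun] at hΦd
  refine ⟨_, hΦd, ?_⟩
  -- injectivity of the derivative
  set a := g v with ha
  set T' := deriv T a with hT'
  have hD : ∀ w, ((T (g v)).comp (ContinuousLinearMap.id ℝ (𝔼 3)) +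
      (((1 : ℝ →L[ℝ] ℝ).smulRight T').comp (m • χ')).flip (id v)) w =
        mulVecE (Q.toFun a) w + (m * χ' w) • T' v := by
    intro w
    simp only [add_apply, ContinuousLinearMap.comp_apply,
      ContinuousLinearMap.id_apply, ContinuousLinearMap.flip_apply, ContinuousLinearMap.smulRight_apply,
      smul_apply, one_apply_eq_self, smul_eq_mul, id, hT, matCLM_apply]
    rw [← ha]
  intro w₁ w₂ h12
  rw [← sub_eq_zero] at h12 ⊢
  set w := w₁ - w₂ with hw
  have h0 : mulVecE (Q.toFun a) w + (m * χ' w) • T' v = 0 := by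
    rw [← hD, map_sub]; exact h12
  -- `w = -(m χ' w) • Q⁻¹(a) T'(v)`
  have hw' : w = -((m * χ' w) • mulVecE (Q.inv a) (T' v)) := by
    have h1 := congrArg (mulVecE (Q.inv a)) h0
    rw [mulVecE_zero, ← matCLM_apply (Q.inv a), map_add, map_smul, matCLM_apply, matCLM_apply,
      mulVecE_inv_mulVecE Q] at h1
    exact eq_neg_of_add_eq_zero_left h1
  have hm0 : 0 ≤ m := Real.smoothTransition.nonneg s
  have hm1 : m ≤ 1 := Real.smoothTransition.le_one s
  have hK := Q.one_le_entryBound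
  have hK' := Q.lipBound_nonneg
  have hC := transitionLip_pos
  have hT'v : ‖T' v‖ ≤ 9 * Q.lipBound * ‖v‖ :=
    (T'.le_opNorm v).trans (mul_le_mul_of_nonneg_right (norm_deriv_matCLM_toFun_le Q a) (norm_nonneg _))
  have hQinv : ‖mulVecE (Q.inv a) (T' v)‖ ≤ 9 * Q.entryBound * ‖T' v‖ :=
    norm_mulVecE_le (fun i j ↦ Q.abs_inv_le a i j) _
  have hχw : |χ' w| ≤ ‖χ'‖ * ‖w‖ := by
    have := χ'.le_opNorm w; rwa [Real.norm_eq_abs] at this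
  have hsmall := Q.const_div_le hL
  -- `‖w‖ ≤ (81 K K' C_σ / L) ‖w‖ ≤ (1/6) ‖w‖`
  have hbound : ‖w‖ ≤ (1 / 6) * ‖w‖ := by
    have h1 : ‖w‖ ≤ |m * χ' w| * ‖mulVecE (Q.inv a) (T' v)‖ := by
      conv_lhs => rw [hw']
      rw [norm_neg, norm_smul, Real.norm_eq_abs]
    have h2 : |m * χ' w| ≤ ‖χ'‖ * ‖w‖ := by
      rw [abs_mul, abs_of_nonneg hm0]
      calc m * |χ' w| ≤ 1 * |χ' w| := mul_le_mul_of_nonneg_right hm1 (abs_nonneg _)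
        _ ≤ ‖χ'‖ * ‖w‖ := by rw [one_mul]; exact hχw
    have h3 : ‖mulVecE (Q.inv a) (T' v)‖ ≤ 9 * Q.entryBound * (9 * Q.lipBound * ‖v‖) :=
      hQinv.trans (mul_le_mul_of_nonneg_left hT'v (by positivity))
    calc ‖w‖ ≤ (‖χ'‖ * ‖w‖) * (9 * Q.entryBound * (9 * Q.lipBound * ‖v‖)) :=
          h1.trans (mul_le_mul h2 h3 (norm_nonneg _) (by positivity))
      _ = 81 * Q.entryBound * Q.lipBound * (‖χ'‖ * ‖v‖) * ‖w‖ := by ring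
      _ ≤ 81 * Q.entryBound * Q.lipBound * (transitionLip / L) * ‖w‖ := by
          refine mul_le_mul_of_nonneg_right (mul_le_mul_of_nonneg_left hχb (by positivity)) (norm_nonneg _)
      _ = 3 * (27 * Q.entryBound * Q.lipBound * transitionLip / L) * ‖w‖ := by ring
      _ ≤ 3 * (1 / 18) * ‖w‖ := by
          refine mul_le_mul_of_nonneg_right (mul_le_mul_of_nonneg_left hsmall (by norm_num)) (norm_nonneg _)
      _ = (1 / 6) * ‖w‖ := by ring
  have : ‖w‖ ≤ 0 := by linarith [norm_nonneg w]
  exact norm_le_zero_iff.1 this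

/-- **The radial linearization is a local diffeomorphism at every point** for `L ≥ L₀(Q)` (inverse
function theorem: the derivative is an injective endomorphism of `ℝ³`, hence invertible). [cite: GompfAGT2010, §4 ¶2 (an isotopy rel p straightening the linear monodromy near 0)] -/
theorem isLocalDiffeomorphAt_radialLinMap (hρ : 0 < ρ) (hL : Q.radialScale ≤ L) (s : ℝ) (v : 𝔼 3) :
    IsLocalDiffeomorphAt 𝓘(ℝ, 𝔼 3) 𝓘(ℝ, 𝔼 3) ∞ (radialLinMap Q ρ L s) v := by
  have hLpos : 0 < L := Q.radialScale_pos.trans_le hL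
  obtain ⟨D, hD, hinj⟩ := exists_hasFDerivAt_radialLinMap Q hρ hL s v
  set e : 𝔼 3 ≃L[ℝ] 𝔼 3 := (LinearEquiv.ofInjectiveEndo D.toLinearMap hinj).toContinuousLinearEquiv
    with he
  have hecoe : (e : 𝔼 3 →L[ℝ] 𝔼 3) = D := by
    ext w
    rfl
  have hsmooth : ContDiff ℝ ∞ (radialLinMap Q ρ L s) :=
    (contDiff_radialLinMap Q hρ hLpos).comp (contDiff_const.prodMk contDiff_id)
  refine isLocalDiffeomorphAt_of_hasFDerivAt_writtenInExtChartAt (I := 𝓘(ℝ, 𝔼 3))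
    (J := 𝓘(ℝ, 𝔼 3)) isOpen_univ (mem_univ v) (contMDiff_iff_contDiff.2 hsmooth).contMDiffOn
    (by exact_mod_cast (le_top : (1 : ℕ∞) ≤ ⊤)) e ?_
  rw [hecoe]
  simpa only [writtenInExtChartAt, extChartAt_model_space_eq_id, PartialEquiv.refl_coe,
    PartialEquiv.refl_symm, CompTriple.comp_eq, id_eq] using hD

end Radial

end Literature.Topology.FourManifolds
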